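import Mathlib
import Summits.NavierStokesRegularity.NavierStokesRegularity.Theorems.L3TimeExponentPincerFullMorreyMostTimes
import HarnessLib.Audit
import HarnessLib

/-!
# Backward `L³` modulation closes stub 2 on the full-Morrey class; without it, failure of the `L³`-Type-I
# pace means unbounded-ratio `L³` bursts (route `L3TimeExponentPincer`, child crux
# `stmt-NavierStokesRegularity-19139` EffSatBlowup, line `pace`, stub 2 `stub_morreyTypeI_slow`; support file 8
# of seat p4)

Support file (cell ns-regularity-ideate, seat p4, gen 5).  0 `sorry`, no definitions.

Write `Λ(t) = ‖u(t)‖₃³` and `s = T - t`.  Support file 7 (`L3TimeExponentPincerFullMorreyMostTimes`) proved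
that on the full-Morrey (scaled-energy-Type-I) class the `L³`-fast set `F_A = {t : Λ(t) > A/√s}` has density
`0` at `T` for EVERY `A > 0`, while stub 2 of line `pace` asks for `F_A = ∅` near `T` for SOME `A` (`L3Slow`).
This file identifies what separates the two: a **backward modulation bound** — for some `K > 0`, `θ ∈ (0,1]`
and all late `t`,
  `Λ(t) ≤ K · Λ(t')` for every `t'` in the last `θ`-fraction `(t - θ s, t)` of the remaining time —
i.e. the `L³` norm cubed cannot jump by more than a fixed factor within a fixed fraction of the blow-up clock.

* §1  `forall_le_threshold_of_density_zero_of_modulation` — pure real analysis: for any `Λ : ℝ → ℝ≥0∞`, density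
  `0` at `T` of every fast set + backward modulation ⇒ `Λ(t) ≤ A/√(T-t)` near `T` for EVERY `A > 0`.  (An
  `A`-fast time `t` makes the whole block `(t - θs, t)` `A/K`-fast; that block has density `≥ θ/(1+θ)` in
  `(T - (1+θ)s, T)`, contradicting density `0` of `F_{A/K}`.)
* §2  `l3Pace_allLevels_of_fullMorrey_of_modulation`, `l3Slow_of_fullMorrey_of_modulation`,
  `effSatNear_of_fullMorrey_of_modulation_of_blowup` — for a frame solution (classical on `[0,T)`, Leray–Hopf)
  that is full-Morrey-Type-I near `T`: backward modulation ⇒ the pace inequality at every level `A > 0` ⇒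
  `L3Slow u T` ⇒ (for a blow-up from a rapidly decaying datum) the crux clause `EffSatNear u T` (= `K₃(1)`), by the
  landed stub 1 and the slow slice.  So **on the full-Morrey class stub 2 reduces to backward `L³` modulation**.
* §3  `l3Burst_of_not_l3Slow_of_fullMorrey`, `l3Burst_of_not_effSatNear_of_fullMorrey_blowup` — contrapositive:
  if stub 2's conclusion (or the crux clause) FAILS for a full-Morrey frame solution, then for every `K`, every
  `θ ∈ (0,1]` and every `T₁ < T` there are `t ∈ (T₁,T)` and `t' ∈ (t - θ(T-t), t)` with `K Λ(t') < Λ(t)`: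
  **`L³` bursts of unbounded ratio on vanishing fractions of the blow-up clock** — the precise shape of the
  "sparse sub-parabolic spike" obstruction (nsreg-p2 R-8.1) on this class.
* §4  `effSatNear_iff_l3Slow_of_morreyTypeI_blowup`, `effSatNear_iff_l3Slow_of_fullMorrey_blowup` — per-solution
  form of the tree's frame-level `effSatBlowupMTI_iff_morreyTypeISlowB'`: for a single frame blow-up in the
  Morrey-Type-I class (`MorreyTypeINear`, a fortiori `FullMorreyTypeINear`) the crux clause near `T` is
  EQUIVALENT to `L3Slow` (energy bound from the Leray–Hopf inequality).

WHAT THIS IS NOT: not a claim about Navier–Stokes regularity; the modulation bound is a HYPOTHESIS (not known for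
Navier–Stokes — the `L³` balance `d/dt‖u‖₃³ ≤ (C/ν) ‖u‖₃² ‖∇|u|^{3/2}‖₂²` closes only for small `‖u‖₃`); no item
or stub is closed.  References: THEOREM J′ (nsreg-p2 ROUND-9 / nsreg-p4 g4); support file 7 (p441596).
-/

noncomputable section

namespace Summit.NavierStokesRegularity.NavierStokesRegularity.Theorems.L3TimeExponentPincerFullMorreyModulation

open MeasureTheory Set Function Filter Metric Topology
open scoped ENNReal NNReal
open Literature.Analysis.FluidPDE
open Summit.NavierStokesRegularity.NavierStokesRegularity.Theorems.L3TimeExponentPincerJawFullMorrey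
  (FullMorreyTypeINear morreyTypeINear_of_full)
open Summit.NavierStokesRegularity.NavierStokesRegularity.Theorems.L3TimeExponentPincerPaceDichotomy
  (EffSatNear L3Slow MorreyTypeINear l3Slow_of_effSatNear_of_morreyTypeI)
open Summit.NavierStokesRegularity.NavierStokesRegularity.Theorems.L3TimeExponentPincerStubParabolicConcentration
  (effSatNear_of_blowup_of_l3Slow)
open Summit.NavierStokesRegularity.NavierStokesRegularity.Theorems.L3TimeExponentPincerFullMorreyMostTimes
  (fastSet_density_zero_of_fullMorrey)

/-! ## §1  Real analysis: density zero of every fast set + backward modulation ⇒ every pace level -/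

/-- **Density zero + backward modulation ⇒ the pace inequality at every level.**  Let `Λ : ℝ → ℝ≥0∞`.  Suppose
(i) for every `A > 0` the set `{t : A/√(T-t) < Λ t}` has density `0` at `T`
(`∀ ε > 0 ∃ h₀ > 0 ∀ h ∈ (0,h₀), |{…} ∩ (T-h,T)| ≤ ε h`), and (ii) backward modulation: for some `K > 0`,
`θ ∈ (0,1]`, `T₁ < T`, `Λ t ≤ K Λ t'` whenever `T₁ < t < T` and `t - θ(T-t) < t' < t`.  Then for every `A > 0`
there is `T₃ < T` with `Λ t ≤ A/√(T-t)` for all `t ∈ (T₃,T)`. -/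
theorem forall_le_threshold_of_density_zero_of_modulation {Λ : ℝ → ℝ≥0∞} {T : ℝ}
    (hdens : ∀ A : ℝ, 0 < A → ∀ ε : ℝ, 0 < ε → ∃ h₀ : ℝ, 0 < h₀ ∧ ∀ h : ℝ, 0 < h → h < h₀ →
      volume ({t | ENNReal.ofReal (A / Real.sqrt (T - t)) < Λ t} ∩ Ioo (T - h) T) ≤ ENNReal.ofReal (ε * h))
    (hmod : ∃ K : ℝ, 0 < K ∧ ∃ θ : ℝ, 0 < θ ∧ θ ≤ 1 ∧ ∃ T₁ < T, ∀ t ∈ Ioo T₁ T,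
      ∀ t' ∈ Ioo (t - θ * (T - t)) t, Λ t ≤ ENNReal.ofReal K * Λ t')
    {A : ℝ} (hA : 0 < A) :
    ∃ T₃ < T, ∀ t ∈ Ioo T₃ T, Λ t ≤ ENNReal.ofReal (A / Real.sqrt (T - t)) := by
  obtain ⟨K, hK, θ, hθ, hθ1, T₁, hT₁, hmod⟩ := hmod
  -- density zero of the `A/K`-fast set with `ε = θ/4`
  obtain ⟨h₀, hh₀, hdens⟩ := hdens (A / K) (div_pos hA hK) (θ / 4) (by positivity)
  refine ⟨max T₁ (T - h₀ / 2), max_lt hT₁ (by linarith), fun t ht => ?_⟩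
  have htT₁ : T₁ < t := lt_of_le_of_lt (le_max_left _ _) ht.1
  have hth₀ : T - h₀ / 2 < t := lt_of_le_of_lt (le_max_right _ _) ht.1
  set s : ℝ := T - t with hs
  have hs0 : 0 < s := sub_pos.2 ht.2
  have hsh : s < h₀ / 2 := by rw [hs]; linarith
  by_contra hfast
  rw [not_le] at hfast
  -- every `t' ∈ (t - θ s, t)` is `A/K`-fast
  have hblock : Ioo (t - θ * s) t ⊆
      {t' | ENNReal.ofReal (A / K / Real.sqrt (T - t')) < Λ t'} ∩ Ioo (T - (1 + θ) * s) T := by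
    intro t' ht'
    have ht'T : t' < T := ht'.2.trans ht.2
    have hs' : s ≤ T - t' := by rw [hs]; linarith [ht'.2]
    have hs'0 : 0 < T - t' := sub_pos.2 ht'T
    refine ⟨?_, ?_, ht'T⟩
    · -- if `Λ t' ≤ (A/K)/√(T-t')` then `Λ t ≤ K Λ t' ≤ A/√(T-t') ≤ A/√s < Λ t`
      by_contra hle
      rw [mem_setOf_eq, not_lt] at hle
      have h1 : Λ t ≤ ENNReal.ofReal K * ENNReal.ofReal (A / K / Real.sqrt (T - t')) :=
        (hmod t ⟨htT₁, ht.2⟩ t' ht').trans (mul_le_mul_of_nonneg_left hle bot_le)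
      have h2 : ENNReal.ofReal K * ENNReal.ofReal (A / K / Real.sqrt (T - t')) =
          ENNReal.ofReal (A / Real.sqrt (T - t')) := by
        rw [← ENNReal.ofReal_mul hK.le]
        congr 1
        field_simp
      have h3 : A / Real.sqrt (T - t') ≤ A / Real.sqrt s :=
        div_le_div_of_nonneg_left hA.le (Real.sqrt_pos.2 hs0) (Real.sqrt_le_sqrt hs')
      rw [h2] at h1
      exact absurd (h1.trans (ENNReal.ofReal_le_ofReal h3)) (not_le.2 hfast)
    · show T - (1 + θ) * s < t'
      have := ht'.1
      nlinarith
  -- measure comparison: `θ s ≤ |block| ≤ |F_{A/K} ∩ (T-(1+θ)s, T)| ≤ (θ/4)(1+θ)s < θ s`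
  have hh : 0 < (1 + θ) * s := by positivity
  have hhh : (1 + θ) * s < h₀ := by nlinarith
  have hup := hdens ((1 + θ) * s) hh hhh
  have hlow : ENNReal.ofReal (θ * s) ≤
      volume ({t' | ENNReal.ofReal (A / K / Real.sqrt (T - t')) < Λ t'} ∩ Ioo (T - (1 + θ) * s) T) := by
    have hv : volume (Ioo (t - θ * s) t) = ENNReal.ofReal (θ * s) := by
      rw [Real.volume_Ioo]; congr 1; ring
    rw [← hv]
    exact measure_mono hblock
  have hlt : θ / 4 * ((1 + θ) * s) < θ * s := by
    have h1 : θ / 4 * ((1 + θ) * s) = θ * s * ((1 + θ) / 4) := by ring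
    rw [h1]
    exact mul_lt_of_lt_one_right (mul_pos hθ hs0) (by linarith)
  exact absurd ((ENNReal.ofReal_le_ofReal_iff (by positivity)).1 (hlow.trans hup)) (not_le.2 hlt)

/-! ## §2  On the full-Morrey class: modulation ⇒ every pace level ⇒ `L3Slow` ⇒ `K₃(1)` -/

/-- **Backward `L³` modulation on the full-Morrey class gives the `L³`-Type-I pace at EVERY level.**  For a
classical solution on `[0,T)`, Leray–Hopf, full-Morrey-Type-I near `T`, satisfying the backward modulation bound
`‖u(t)‖₃³ ≤ K ‖u(t')‖₃³` for all late `t` and all `t' ∈ (t - θ(T-t), t)` (`K > 0`, `0 < θ ≤ 1`): for every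
`A > 0`, `‖u(t)‖₃³ ≤ A/√(T-t)` on a final window (density zero of the fast sets, support file 7, + §1). -/
theorem l3Pace_allLevels_of_fullMorrey_of_modulation {ν T : ℝ} (hν : 0 < ν) (hT : 0 < T)
    {u : ℝ → (EuclideanSpace ℝ (Fin 3)) → (EuclideanSpace ℝ (Fin 3))} {p : ℝ → (EuclideanSpace ℝ (Fin 3)) → ℝ}
    (hcl : IsClassicalNSSolutionOn (Ico 0 T) ν 0 u p) (hLH : IsLerayHopfOn T ν 0 (u 0) u)
    (hFM : FullMorreyTypeINear u T)
    (hmod : ∃ K : ℝ, 0 < K ∧ ∃ θ : ℝ, 0 < θ ∧ θ ≤ 1 ∧ ∃ T₁ < T, ∀ t ∈ Ioo T₁ T,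
      ∀ t' ∈ Ioo (t - θ * (T - t)) t,
        eLpNorm (u t) 3 volume ^ (3 : ℝ) ≤ ENNReal.ofReal K * eLpNorm (u t') 3 volume ^ (3 : ℝ))
    {A : ℝ} (hA : 0 < A) :
    ∃ T₃ < T, ∀ t ∈ Ioo T₃ T, eLpNorm (u t) 3 volume ^ (3 : ℝ) ≤ ENNReal.ofReal (A / Real.sqrt (T - t)) :=
  forall_le_threshold_of_density_zero_of_modulation (Λ := fun t => eLpNorm (u t) 3 volume ^ (3 : ℝ))
    (fun _ hA' => fastSet_density_zero_of_fullMorrey hν hT hcl hLH hFM hA') hmod hA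

/-- **On the full-Morrey class, backward `L³` modulation implies stub 2's conclusion `L3Slow`.** -/
theorem l3Slow_of_fullMorrey_of_modulation {ν T : ℝ} (hν : 0 < ν) (hT : 0 < T)
    {u : ℝ → (EuclideanSpace ℝ (Fin 3)) → (EuclideanSpace ℝ (Fin 3))} {p : ℝ → (EuclideanSpace ℝ (Fin 3)) → ℝ}
    (hcl : IsClassicalNSSolutionOn (Ico 0 T) ν 0 u p) (hLH : IsLerayHopfOn T ν 0 (u 0) u)
    (hFM : FullMorreyTypeINear u T)
    (hmod : ∃ K : ℝ, 0 < K ∧ ∃ θ : ℝ, 0 < θ ∧ θ ≤ 1 ∧ ∃ T₁ < T, ∀ t ∈ Ioo T₁ T,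
      ∀ t' ∈ Ioo (t - θ * (T - t)) t,
        eLpNorm (u t) 3 volume ^ (3 : ℝ) ≤ ENNReal.ofReal K * eLpNorm (u t') 3 volume ^ (3 : ℝ)) :
    L3Slow u T := by
  obtain ⟨T₃, hT₃, h⟩ := l3Pace_allLevels_of_fullMorrey_of_modulation hν hT hcl hLH hFM hmod one_pos
  exact ⟨1, one_pos, T₃, hT₃, h⟩

/-- **… hence the crux clause `K₃(1)` for blow-ups**: a frame blow-up (no smooth extension past `T`, rapidly
decaying datum) that is full-Morrey-Type-I near `T` and backward-`L³`-modulated satisfies `EffSatNear u T`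
(the landed stub 1 + the slow slice, `effSatNear_of_blowup_of_l3Slow`). -/
theorem effSatNear_of_fullMorrey_of_modulation_of_blowup {ν T : ℝ} (hν : 0 < ν) (hT : 0 < T)
    {u : ℝ → (EuclideanSpace ℝ (Fin 3)) → (EuclideanSpace ℝ (Fin 3))} {p : ℝ → (EuclideanSpace ℝ (Fin 3)) → ℝ}
    (hcl : IsClassicalNSSolutionOn (Ico 0 T) ν 0 u p) (hLH : IsLerayHopfOn T ν 0 (u 0) u)
    (hdec : HasRapidSpatialDecay (u 0)) (hnext : ¬ HasSmoothExtensionPast ν 0 u T)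
    (hFM : FullMorreyTypeINear u T)
    (hmod : ∃ K : ℝ, 0 < K ∧ ∃ θ : ℝ, 0 < θ ∧ θ ≤ 1 ∧ ∃ T₁ < T, ∀ t ∈ Ioo T₁ T,
      ∀ t' ∈ Ioo (t - θ * (T - t)) t,
        eLpNorm (u t) 3 volume ^ (3 : ℝ) ≤ ENNReal.ofReal K * eLpNorm (u t') 3 volume ^ (3 : ℝ)) :
    EffSatNear u T :=
  effSatNear_of_blowup_of_l3Slow hν hT hcl hLH hdec hnext (l3Slow_of_fullMorrey_of_modulation hν hT hcl hLH hFM hmod)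

/-! ## §3  Contrapositive: failure of the pace forces unbounded-ratio `L³` bursts -/

/-- **No `L³`-Type-I pace on the full-Morrey class ⇒ `L³` bursts of unbounded ratio.**  If a classical
solution on `[0,T)`, Leray–Hopf, full-Morrey-Type-I near `T`, is NOT `L³`-slow (stub 2's conclusion fails), then
for every `K > 0`, every `θ ∈ (0,1]` and every `T₁ < T` there are times `t ∈ (T₁,T)` and `t' ∈ (t - θ(T-t), t)`
with `K ‖u(t')‖₃³ < ‖u(t)‖₃³`. -/
theorem l3Burst_of_not_l3Slow_of_fullMorrey {ν T : ℝ} (hν : 0 < ν) (hT : 0 < T)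
    {u : ℝ → (EuclideanSpace ℝ (Fin 3)) → (EuclideanSpace ℝ (Fin 3))} {p : ℝ → (EuclideanSpace ℝ (Fin 3)) → ℝ}
    (hcl : IsClassicalNSSolutionOn (Ico 0 T) ν 0 u p) (hLH : IsLerayHopfOn T ν 0 (u 0) u)
    (hFM : FullMorreyTypeINear u T) (hns : ¬ L3Slow u T) :
    ∀ K : ℝ, 0 < K → ∀ θ : ℝ, 0 < θ → θ ≤ 1 → ∀ T₁ < T, ∃ t ∈ Ioo T₁ T, ∃ t' ∈ Ioo (t - θ * (T - t)) t,
      ENNReal.ofReal K * eLpNorm (u t') 3 volume ^ (3 : ℝ) < eLpNorm (u t) 3 volume ^ (3 : ℝ) := by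
  intro K hK θ hθ hθ1 T₁ hT₁
  by_contra hcon
  simp only [not_exists, not_and, not_lt] at hcon
  exact hns (l3Slow_of_fullMorrey_of_modulation hν hT hcl hLH hFM
    ⟨K, hK, θ, hθ, hθ1, T₁, hT₁, fun t ht t' ht' => hcon t ht t' ht'⟩)

/-- **Failure of the crux clause on a full-Morrey blow-up ⇒ `L³` bursts of unbounded ratio**: a frame blow-up
(rapidly decaying datum, no smooth extension past `T`) that is full-Morrey-Type-I near `T` and violates
`EffSatNear u T` has, for every `K`, `θ ∈ (0,1]`, `T₁ < T`, times `t ∈ (T₁,T)`, `t' ∈ (t - θ(T-t), t)` with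
`K ‖u(t')‖₃³ < ‖u(t)‖₃³`. -/
theorem l3Burst_of_not_effSatNear_of_fullMorrey_blowup {ν T : ℝ} (hν : 0 < ν) (hT : 0 < T)
    {u : ℝ → (EuclideanSpace ℝ (Fin 3)) → (EuclideanSpace ℝ (Fin 3))} {p : ℝ → (EuclideanSpace ℝ (Fin 3)) → ℝ}
    (hcl : IsClassicalNSSolutionOn (Ico 0 T) ν 0 u p) (hLH : IsLerayHopfOn T ν 0 (u 0) u)
    (hdec : HasRapidSpatialDecay (u 0)) (hnext : ¬ HasSmoothExtensionPast ν 0 u T)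
    (hFM : FullMorreyTypeINear u T) (hns : ¬ EffSatNear u T) :
    ∀ K : ℝ, 0 < K → ∀ θ : ℝ, 0 < θ → θ ≤ 1 → ∀ T₁ < T, ∃ t ∈ Ioo T₁ T, ∃ t' ∈ Ioo (t - θ * (T - t)) t,
      ENNReal.ofReal K * eLpNorm (u t') 3 volume ^ (3 : ℝ) < eLpNorm (u t) 3 volume ^ (3 : ℝ) :=
  l3Burst_of_not_l3Slow_of_fullMorrey hν hT hcl hLH hFM
    fun hslow => hns (effSatNear_of_blowup_of_l3Slow hν hT hcl hLH hdec hnext hslow)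

/-! ## §4  Per-solution equivalence: on Morrey-Type-I blow-ups the clause IS the pace -/

/-- **For a single Morrey-Type-I frame blow-up, `K₃(1)` near `T` ⟺ `L³`-Type-I pace** (per-solution form of the
tree's frame-level `effSatBlowupMTI_iff_morreyTypeISlowB'`): `→` by `l3Slow_of_effSatNear_of_morreyTypeI` with the
Leray–Hopf energy bound, `←` by the landed stub 1 + slow slice. -/
theorem effSatNear_iff_l3Slow_of_morreyTypeI_blowup {ν T : ℝ} (hν : 0 < ν) (hT : 0 < T)
    {u : ℝ → (EuclideanSpace ℝ (Fin 3)) → (EuclideanSpace ℝ (Fin 3))} {p : ℝ → (EuclideanSpace ℝ (Fin 3)) → ℝ}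
    (hcl : IsClassicalNSSolutionOn (Ico 0 T) ν 0 u p) (hLH : IsLerayHopfOn T ν 0 (u 0) u)
    (hdec : HasRapidSpatialDecay (u 0)) (hnext : ¬ HasSmoothExtensionPast ν 0 u T)
    (hM : MorreyTypeINear u T) : EffSatNear u T ↔ L3Slow u T := by
  refine ⟨fun hK => ?_, effSatNear_of_blowup_of_l3Slow hν hT hcl hLH hdec hnext⟩
  have he : 0 ≤ 2 * VectorCalculus.kineticEnergy (u 0) := mul_nonneg zero_le_two (kineticEnergy_nonneg _)
  exact l3Slow_of_effSatNear_of_morreyTypeI he hT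
    (fun t ht => hLH.lintegral_enorm_sq_le hν.le ⟨ht.1.le, ht.2.le⟩) hK hM

/-- The same on the full-Morrey (scaled-energy-Type-I) class. -/
theorem effSatNear_iff_l3Slow_of_fullMorrey_blowup {ν T : ℝ} (hν : 0 < ν) (hT : 0 < T)
    {u : ℝ → (EuclideanSpace ℝ (Fin 3)) → (EuclideanSpace ℝ (Fin 3))} {p : ℝ → (EuclideanSpace ℝ (Fin 3)) → ℝ}
    (hcl : IsClassicalNSSolutionOn (Ico 0 T) ν 0 u p) (hLH : IsLerayHopfOn T ν 0 (u 0) u)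
    (hdec : HasRapidSpatialDecay (u 0)) (hnext : ¬ HasSmoothExtensionPast ν 0 u T)
    (hFM : FullMorreyTypeINear u T) : EffSatNear u T ↔ L3Slow u T :=
  effSatNear_iff_l3Slow_of_morreyTypeI_blowup hν hT hcl hLH hdec hnext (morreyTypeINear_of_full hFM)

end Summit.NavierStokesRegularity.NavierStokesRegularity.Theorems.L3TimeExponentPincerFullMorreyModulation

end
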